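import Literature.MathematicalPhysics.QuantumFieldTheory.Balaban1983to89.B11Eq7Convention
import Literature.MathematicalPhysics.QuantumFieldTheory.Balaban1983to89.B8Eq131Derivation

/-!
# `Balaban1983to89.B11Eq20BoundB` — T. Bałaban, *The variational problem and background fields in renormalization group
# method for lattice gauge theories*, Commun. Math. Phys. **102** (1985) 277–309 [Balaban1985Variational]: the clause of
# (20) p. 281 *"where B is given by the formulas (1.31) in [6], hence |B| < 2dLC₁ε₁"* on the concrete lattices of
# `B11Eq7Convention` (theorems only)

statement-level skeleton of published theorems with citation tags; proofs where landed; nothing here is a claim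
about the Yang–Mills mass gap

PDF held: `paper:balaban1985-cmp102-variational-background` (journal page = PDF page + 276), p. 281 (PDF 5) read from the
held text; "[6]" = [Balaban1985RegularSpaces] (cell paper B8, `paper:balaban1985-cmp99-regular-spaces-gauge-fixing`, journal
page = PDF page + 74), p. 82 (PDF 8) read from the held text and the render `…-regular-spaces-gauge-fixing-p008-x2.png`.

WHAT IS REPRODUCED (mega-formalization `lit-balaban`, HOME `run/shared/lean/pub/lit-balaban/`, Phase-2 proof seat `p29`
gen 5, unit `lit-balaban-p29`; SKELETON row `B11.Eq19` of reader r08's `ROWS-B11.md`, whose (19)–(21) are typed as the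
carrier predicate `B11.LGData.In19_21`).  THE PRINTED TEXT (p. 281): *"for an arbitrary configuration U = U′U₀ from (18)
there exists exactly one gauge transformation u … such that U₁ = U′u⁻¹ satisfies the conditions (1.36)–(1.39) of [6]. …
Q_j(U₀, ηA) = B on Λ_j, j = 0, 1, …, k, (20) where B is given by the formulas (1.31) in [6], hence |B| < 2dLC₁ε₁"*;
(14) p. 280: *"|Ū₀ʲ − V| < C₁ε₁ on Λ_j, j = 0, 1, …, k"*; (3) p. 278: *"Ūʲ = V on Λ_j"* (the space `𝔅_k(𝔅_k, V)` of
(18)).  [6] p. 82: *"All sites of the contours Γ_{b₋,x} belong to Λ_{j−1} … Let us denote V(Ū₀ʲ)⁻¹ = V′"*, (1.31):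
`B_b = (1/i) log V′_b` if `b ⊂ Λ_j`, `B_b = (1/i) log(exp[−i Σ_{x∈B(b₋)} L^{−d}(1/i) log(R̄^{j−1}_{0,b₋}V′)(Γ_{b₋,x})] V′_b)`
if `b₋ ∈ Λ_{j−1}`, `b₊ ∈ Λ_j`; (1.35): *"|(U′U₀)‾ʲ − Ū₀ʲ| < α₁ on Λ_j … It is satisfied if … |V − Ū₀ʲ| < α₁"*;
(1.37): *"B is given by formula (1.31) with V′ = Ũ′ʲ, |B| < 2dLα₁ by the assumption (1.35)"*.

THIS FILE proves the *"hence"*: on the concrete carriers of `B11Eq7Convention` (`Λ_j` = `Lam L Ω k j` in the coordinates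
of the `L^jη`-lattice, the data `V : ℕ → (Site d → Fin d → 𝔸ˣ)`, (3) = `InB`, the admissibility (1) = the tree's
`B8ConstraintBonds.DomainSeq`) and with (14) in the form landed by `B11Eq13Concrete.sat14_L3` (`|Ū₀ʲ_b − V_b| < C₁ε₁` at
every level-`j` bond `b` touching `Λ_j`), the configuration `B` of (1.31) of [6] with `V′ = V(Ū₀ʲ)⁻¹` — the tree's
`B8Thm2LogB.Bint` (interior bonds) and `B8Thm2LogB.Bcross` (crossing bonds, block average of [6] read through
`B8Lemma1NonAbelian.covProd`/`pert`) — satisfies `|B_b| < 2dLC₁ε₁` on BOTH kinds of bonds of `𝔅_k`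
(`ineq20_interior`, `ineq20_crossing`, assembled in `ineq20`), by (1.37) of [6] = `B8Thm2LogB.ineq137_interior` /
`ineq137_of_ineq135` with `α₁ := C₁ε₁`.  The one geometric input of the crossing case, [6]'s sentence *"All sites of
the contours Γ_{b₋,x} belong to Λ_{j−1}"*, is PROVED from the admissibility (1) (`block_mem_lam`: block saturation puts
the block of `b₋` outside `Ω_j` with `b₋`, the collar around the block of `b₊ ∈ Λ_j` puts it inside `Ω_{j−1}`), so (14)
is available on every bond the formula (1.31) reads.  Dictionary with Theorem 2 of [6] (the preceding sentence of
p. 281): for `U ∈ 𝔅_k(𝔅_k, V)` ((3)), [6]'s `V′ = Ũ′ʲ = Ūʲ(Ū₀ʲ)⁻¹` ((1.20); `pert` of the averages = `tildIter`, r05's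
`pert_avgIter_eq_tildIter`) IS B11's `V(Ū₀ʲ)⁻¹` on the bonds touching `Λ_j` (`pert_avgIter_eq_of_inB`), the two `B`'s
coincide bond by bond (`bint_tilde_eq`, `bcross_tilde_eq`, by locality `crossSum_congr_of_agreeOn`), and (3) ∧ (14) give
(1.35) of [6] with `α₁ = C₁ε₁` (`ineq135_of_inB`).
MODEL NOTES.  (M1)–(M4) of `B11Eq7Convention` and the typing of `B8Thm2LogB` are inherited: lattices on `ℤ^d`, level `j`
in its own coordinates (`Ūʲ = avgIter L U j`); a level-`(j+1)` bond `b = ⟨y, y + e_κ⟩` has `b₋ ∈ Λ_j` iff its point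
`L^{j+1}y` lies in `B^j(Λ_j)`, i.e. iff the level-`j` point `Ly` (the corner of the block `B(b₋)`) lies in `Lam L Ω k j`
(`smul_mem_lam_iff`); "unitary" = `U1`-valued (`B7Prop1Explicit.U1`), assumed of the data `V` and of the averages of `U₀`
as in `B8Thm2LogB`/`B8Eq131Derivation` (hypotheses); *"ε₁ sufficiently small"* = [6]'s explicit `dLα₁ ≤ 1/8` of
`B8Thm2LogB` at `α₁ = C₁ε₁`.  (M5) (1.31) lists interior bonds `b ⊂ Λ_j` and crossing bonds `b₋ ∈ Λ_{j−1}, b₊ ∈ Λ_j`;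
the interior bound is proved at every bond touching `Λ_j` (where (14) is available), the crossing bound for the printed
orientation AND for the mirrored one `b₋ ∈ Λ_j, b₊ ∈ Λ_{j−1}` left to the reader by [6] (`ineq20_crossing_mirrored`).
HONEST SCOPE.  NOT proved here: the equality `Q_j(U₀, ηA) = B` itself (the existence of the gauge transformation `u`
of Theorem 2 of [6] — a statement row, `B8.Thm2`; r05's `B8Eq131Derivation.eq137_interior/eq137_crossing` give the
identity `exp iB_b = (Ū₁ʲ)_b` under [3] (87)), the bounds (19), the Landau condition (21) and `ε₂ ≥ B₁(ε₀ + C₁ε₁)`.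
No `sorry`, no definitions, no new named facts (net debt delta 0); axioms `propext`, `Classical.choice`, `Quot.sound`.
-/

noncomputable section

open scoped BigOperators
open NormedSpace Finset

namespace Literature.MathematicalPhysics.QuantumFieldTheory.Balaban1983to89.B11Eq20BoundB

open B7Prop1Explicit B7Prop2Explicit B7Prop1Local B8Ineq132 B11Eq7Convention
open B8ConstraintBonds (DomainSeq)
open B8Lemma1NonAbelian (pert covProd e_nonneg)
open B8Thm2LogB (blockTop Bint Bcross BcrossMirror crossSum crossMid)
open B8Eq131Derivation (covProd_eq_tHol tHol_congr_of_agree pert_avgIter_eq_tildIter)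
open B8Eq119TwistedAxial (treeWord_boxVec_forward)
open B7Eq92Concrete (tildIter)

export B7Prop1Explicit (Site) -- the `ℤ^d` sites (the torus `Site` of `Setup.lean` would shadow them)

variable {d : ℕ}

/-! ## §1 Geometry: *"All sites of the contours Γ_{b₋,x} belong to Λ_{j−1}"* ([6] p. 82) from the admissibility (1) -/

section Geometry

/-- The point `L^{j+1}y` of the `L^{j+1}η`-lattice is the point `L^j(Ly)` of the `L^jη`-lattice. [folklore] -/
private theorem loK_succ (L j : ℕ) (y : Site d) : loK L (j + 1) y = loK L j ((L : ℤ) • y) := by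
  funext i
  simp only [loK, Pi.smul_apply, smul_eq_mul, pow_succ]
  ring

/-- "`b₋ ∈ Λ_j`" for the start `y` of a bond of the `L^{j+1}η`-lattice (its point `L^{j+1}ηy` lies in `B^j(Λ_j)`) ⟺ the
block corner `Ly`, a level-`j` point, lies in `Lam L Ω k j`. [cite: Balaban1985RegularSpaces, (1.5) p.77, (1.31) p.82] -/
theorem smul_mem_lam_iff {L : ℕ} {Ω : ℕ → Set (Site d)} {k j : ℕ} {y : Site d} :
    (L : ℤ) • y ∈ Lam L Ω k j ↔ loK L (j + 1) y ∈ layer Ω k j := by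
  rw [loK_succ]
  rfl

/-- **"All sites of the contours `Γ_{b₋,x}` belong to `Λ_{j−1}`"** ([6] p. 82), one level up, either orientation: if
the level-`j` block corner `Lw` lies in `Λ_j` (`j < k`) and a level-`(j+1)` point `v` with `|v − w|_∞ ≤ 1` lies in
`Λ_{j+1}`, then EVERY level-`j` point `z` of the block `B(w) = Lw + [0, L)^d` lies in `Λ_j`: its fine site `L^jz` lies
in the `(j+1)`-block of `w`, hence outside `Ω_{j+1}` with `L^{j+1}w` (block saturation of (1)), and inside the `3^d`
blocks around the block of `v ∈ Ω_{j+1}^{(j+1)}`, hence in `Ω_j` (the collar of (1)).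
[cite: Balaban1985RegularSpaces, p.82 (before (1.31)), (1.4) p.77; Balaban1985Variational, (1) p.277] -/
theorem block_mem_lam_of_near {L : ℕ} (hL : 1 ≤ L) {Ω : ℕ → Set (Site d)} (hΩ : DomainSeq L Ω) {k j : ℕ}
    (hjk : j < k) {w v : Site d} (hcorner : (L : ℤ) • w ∈ Lam L Ω k j) (hv : v ∈ Lam L Ω k (j + 1))
    (hwv : ∀ i, v i - 1 ≤ w i ∧ w i ≤ v i + 1) {z : Site d} (hlo : (L : ℤ) • w ≤ z)
    (hhi : z ≤ (L : ℤ) • w + blockTop L) : z ∈ Lam L Ω k j := by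
  have hP : (1 : ℤ) ≤ (L : ℤ) ^ j := one_le_pow₀ (by exact_mod_cast hL)
  have hPs : (L : ℤ) ^ (j + 1) = (L : ℤ) ^ j * L := pow_succ _ _
  have hzi : ∀ i, (L : ℤ) * w i ≤ z i ∧ z i ≤ (L : ℤ) * w i + ((L : ℤ) - 1) := fun i => by
    have h1 := hlo i
    have h2 := hhi i
    simp only [Pi.add_apply, Pi.smul_apply, smul_eq_mul, blockTop] at h1 h2
    exact ⟨h1, h2⟩
  -- the fine site `L^j z` lies in the `(j+1)`-block of `w`
  have hunder : Under L (j + 1) w (loK L j z) := fun i => by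
    obtain ⟨h1, h2⟩ := hzi i
    simp only [loK]
    rw [hPs]
    have hP0 : (0 : ℤ) ≤ (L : ℤ) ^ j := by linarith
    constructor <;> nlinarith [mul_le_mul_of_nonneg_left h1 hP0, mul_le_mul_of_nonneg_left h2 hP0]
  have hout : loK L (j + 1) w ∉ Ω (j + 1) := (smul_mem_lam_iff.1 hcorner).2 hjk
  refine ⟨?_, fun _ hz => hout ((mem_iff_of_under hL hΩ hunder).1 hz)⟩
  -- `L^j z ∈ Ω_j` by the collar around the block of `v`
  refine mem_of_fatBlock hL hΩ hv.1 fun i => ?_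
  obtain ⟨h1, h2⟩ := hzi i
  obtain ⟨h3, h4⟩ := hwv i
  have hP0 : (0 : ℤ) ≤ (L : ℤ) ^ j := by linarith
  have hPL0 : (0 : ℤ) ≤ (L : ℤ) ^ j * L := by positivity
  simp only [loK]
  rw [hPs]
  constructor <;> nlinarith [mul_le_mul_of_nonneg_left h1 hP0, mul_le_mul_of_nonneg_left h2 hP0,
    mul_le_mul_of_nonneg_left h3 hPL0, mul_le_mul_of_nonneg_left h4 hPL0]

/-- **The printed orientation** `b₋ ∈ Λ_{j−1}`, `b₊ ∈ Λ_j` of (1.31) (one level up: `b = ⟨y, y + e_κ⟩` a bond of the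
`L^{j+1}η`-lattice, `b₋ ∈ Λ_j`, `b₊ ∈ Λ_{j+1}`): every level-`j` point of the block `B(b₋)` lies in `Λ_j`.
[cite: Balaban1985RegularSpaces, p.82 (before (1.31)); Balaban1985Variational, (1) p.277] -/
theorem block_mem_lam {L : ℕ} (hL : 1 ≤ L) {Ω : ℕ → Set (Site d)} (hΩ : DomainSeq L Ω) {k j : ℕ} (hjk : j < k)
    {y : Site d} {κ : Fin d} (hminus : (L : ℤ) • y ∈ Lam L Ω k j) (hplus : y + e κ ∈ Lam L Ω k (j + 1))
    {z : Site d} (hlo : (L : ℤ) • y ≤ z) (hhi : z ≤ (L : ℤ) • y + blockTop L) : z ∈ Lam L Ω k j :=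
  block_mem_lam_of_near hL hΩ hjk hminus hplus (fun i => by
    have he : (0 : ℤ) ≤ e κ i ∧ e κ i ≤ 1 := by
      rw [e_apply]
      split_ifs <;> simp
    simp only [Pi.add_apply]
    exact ⟨by linarith [he.2], by linarith [he.1]⟩) hlo hhi

/-- **The mirrored orientation** `b₋ ∈ Λ_j`, `b₊ ∈ Λ_{j−1}` ([6] p. 79 "e.g.", left to the reader; one level up:
`b₋ = y ∈ Λ_{j+1}`, `b₊ = y + e_κ ∈ Λ_j`): every level-`j` point of the block `B(b₊)` lies in `Λ_j`.
[cite: Balaban1985RegularSpaces, p.82 (before (1.31)); Balaban1985Variational, (1) p.277] -/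
theorem block_mem_lam_mirrored {L : ℕ} (hL : 1 ≤ L) {Ω : ℕ → Set (Site d)} (hΩ : DomainSeq L Ω) {k j : ℕ}
    (hjk : j < k) {y : Site d} {κ : Fin d} (hminus : y ∈ Lam L Ω k (j + 1))
    (hplus : (L : ℤ) • (y + e κ) ∈ Lam L Ω k j) {z : Site d} (hlo : (L : ℤ) • (y + e κ) ≤ z)
    (hhi : z ≤ (L : ℤ) • (y + e κ) + blockTop L) : z ∈ Lam L Ω k j :=
  block_mem_lam_of_near hL hΩ hjk hplus hminus (fun i => by
    have he : (0 : ℤ) ≤ e κ i ∧ e κ i ≤ 1 := by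
      rw [e_apply]
      split_ifs <;> simp
    simp only [Pi.add_apply]
    exact ⟨by linarith [he.1], by linarith [he.2]⟩) hlo hhi

/-- Hence every bond `c` of the block `B(b₋)` (both end-points in the block box `[Lb₋, Lb₋ + (L−1)𝟙]`) "belongs to
`Λ_{j−1}`" in the p. 77 convention of [6] (at least one end-point in `Λ_{j−1}`) — the bonds on which (3) and (14)
speak. [cite: Balaban1985RegularSpaces, p.77 (convention before (1.5)), p.82 (before (1.31))] -/
theorem bondTouches_of_block {L : ℕ} (hL : 1 ≤ L) {Ω : ℕ → Set (Site d)} (hΩ : DomainSeq L Ω) {k j : ℕ}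
    (hjk : j < k) {y : Site d} {κ : Fin d} (hminus : (L : ℤ) • y ∈ Lam L Ω k j)
    (hplus : y + e κ ∈ Lam L Ω k (j + 1)) {z : Site d} {μ : Fin d} (hlo : (L : ℤ) • y ≤ z)
    (hhi : z + e μ ≤ (L : ℤ) • y + blockTop L) : BondTouches (Lam L Ω k j) z μ :=
  Or.inl (block_mem_lam hL hΩ hjk hminus hplus hlo ((le_add_of_nonneg_right (e_nonneg μ)).trans hhi))

end Geometry

/-! ## §2 The dictionary with [6]: (3) ⟹ `V′ = Ũ′ʲ` on `Λ_j`; (3) ∧ (14) ⟹ (1.35) with `α₁ = C₁ε₁` -/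

section Dictionary

variable {𝔸 : Type*} [NormedRing 𝔸] [NormedAlgebra ℂ 𝔸] [CompleteSpace 𝔸]

/-- **(3) ⟹ [6]'s `V′ = Ũ′ʲ`**: for `U ∈ 𝔅_k(𝔅_k, V)` ("Ūʲ = V on Λ_j") the configuration `Ũ′ʲ = Ūʲ(Ū₀ʲ)⁻¹` of (1.20)
of [6] (`pert` of the averages) equals B11's `V′ = V(Ū₀ʲ)⁻¹` at every level-`j` bond touching `Λ_j`.
[cite: Balaban1985Variational, (3) p.278, (20) p.281; Balaban1985RegularSpaces, (1.20) p.79, p.82 ("V(Ū₀ʲ)⁻¹ = V′")] -/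
theorem pert_avgIter_eq_of_inB {L k : ℕ} {Ω : ℕ → Set (Site d)} {V : ℕ → Site d → Fin d → 𝔸ˣ}
    {U : Site d → Fin d → 𝔸ˣ} (h3 : InB L k Ω V U) (U₀ : Site d → Fin d → 𝔸ˣ) {j : ℕ} (hj : j ≤ k)
    {y : Site d} {κ : Fin d} (hb : BondTouches (Lam L Ω k j) y κ) :
    pert (avgIter L U j) (avgIter L U₀ j) y κ = V j y κ * (avgIter L U₀ j y κ)⁻¹ := by
  show avgIter L U j y κ * (avgIter L U₀ j y κ)⁻¹ = _
  rw [h3 j hj y κ hb]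

/-- **(3) ∧ (14) ⟹ (1.35) of [6] with `α₁ = C₁ε₁`**: `|Ūʲ_b − Ū₀ʲ_b| = |V_b − Ū₀ʲ_b| < C₁ε₁` at every level-`j` bond
`b` touching `Λ_j` ([6] p. 82: "(1.35) … is satisfied if … |V − Ū₀ʲ| < α₁"; here `Ūʲ = V` exactly).
[cite: Balaban1985Variational, (3) p.278, (14) p.280; Balaban1985RegularSpaces, (1.35) p.82] -/
theorem ineq135_of_inB {L k : ℕ} {Ω : ℕ → Set (Site d)} {V : ℕ → Site d → Fin d → 𝔸ˣ}
    {U U₀ : Site d → Fin d → 𝔸ˣ} {a : ℝ} (h3 : InB L k Ω V U)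
    (h14 : ∀ j, j ≤ k → ∀ (y : Site d) (κ : Fin d), BondTouches (Lam L Ω k j) y κ →
      ‖((avgIter L U₀ j y κ : 𝔸ˣ) : 𝔸) - (V j y κ : 𝔸)‖ < a)
    {j : ℕ} (hj : j ≤ k) {y : Site d} {κ : Fin d} (hb : BondTouches (Lam L Ω k j) y κ) :
    ‖((avgIter L U j y κ : 𝔸ˣ) : 𝔸) - (avgIter L U₀ j y κ : 𝔸)‖ < a := by
  rw [h3 j hj y κ hb, norm_sub_rev]
  exact h14 j hj y κ hb

omit [CompleteSpace 𝔸] in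
/-- Locality of the exponent sum of (1.31): `Σ_{x∈B(b₋)} L^{−d}(1/i) log(R̄_{0,b₋}V′)(Γ_{b₋,x})` reads `V′` only on the
bonds of the block box `[Lb₋, Lb₋ + (L−1)𝟙]` ("All sites of the contours Γ_{b₋,x} belong to Λ_{j−1}"; the
(1.19)-product is the twisted transport (58) of [3], local by `B8Eq131Derivation.tHol_congr_of_agree`).
[cite: Balaban1985RegularSpaces, (1.31) p.82, (1.19) p.79; Balaban1985Averaging, (58) p.27] -/
theorem crossSum_congr_of_agreeOn (L : ℕ) (hL : 1 ≤ L) (V₀ W W' : Site d → Fin d → 𝔸ˣ) (y : Site d)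
    (h : AgreeOn ((L : ℤ) • y) ((L : ℤ) • y + blockTop L) (W * V₀) (W' * V₀)) :
    crossSum L V₀ W ((L : ℤ) • y) = crossSum L V₀ W' ((L : ℤ) • y) := by
  unfold crossSum
  refine Finset.sum_congr rfl fun r _ => ?_
  rw [covProd_eq_tHol _ _ _ _ (treeWord_boxVec_forward L r), covProd_eq_tHol _ _ _ _ (treeWord_boxVec_forward L r),
    tHol_congr_of_agree L hL V₀ W W' y h r]

omit [CompleteSpace 𝔸] in
/-- Hence `B_b` of (1.31), second line, depends on `V′` only through the block bonds of `B(b₋)` and the bond `b`; the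
mirrored formula likewise. [cite: Balaban1985RegularSpaces, (1.31) p.82] -/
theorem bcross_congr_of_agreeOn (L : ℕ) (hL : 1 ≤ L) (V₀ W W' : Site d → Fin d → 𝔸ˣ) (y : Site d)
    (h : AgreeOn ((L : ℤ) • y) ((L : ℤ) • y + blockTop L) (W * V₀) (W' * V₀)) (w : 𝔸ˣ) :
    Bcross L V₀ W ((L : ℤ) • y) w = Bcross L V₀ W' ((L : ℤ) • y) w := by
  unfold Bcross crossMid
  rw [crossSum_congr_of_agreeOn L hL V₀ W W' y h]

omit [CompleteSpace 𝔸] in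
/-- [cite: Balaban1985RegularSpaces, (1.31) p.82] -/
theorem bcrossMirror_congr_of_agreeOn (L : ℕ) (hL : 1 ≤ L) (V₀ W W' : Site d → Fin d → 𝔸ˣ) (y : Site d)
    (h : AgreeOn ((L : ℤ) • y) ((L : ℤ) • y + blockTop L) (W * V₀) (W' * V₀)) (g w : 𝔸ˣ) :
    BcrossMirror L V₀ W ((L : ℤ) • y) g w = BcrossMirror L V₀ W' ((L : ℤ) • y) g w := by
  unfold BcrossMirror
  rw [crossSum_congr_of_agreeOn L hL V₀ W W' y h]

/-- For `U ∈ 𝔅_k(𝔅_k, V)`: `Ũ′ʲŪ₀ʲ = Ūʲ` and `V′Ū₀ʲ = V` agree on the block box of `B(b₋)` (all its bonds touch `Λ_j`).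
[cite: Balaban1985Variational, (3) p.278; Balaban1985RegularSpaces, p.82 (before (1.31))] -/
theorem agreeOn_block_of_inB {L k : ℕ} (hL : 1 ≤ L) {Ω : ℕ → Set (Site d)} (hΩ : DomainSeq L Ω)
    {V : ℕ → Site d → Fin d → 𝔸ˣ} {U : Site d → Fin d → 𝔸ˣ} (h3 : InB L k Ω V U) (U₀ : Site d → Fin d → 𝔸ˣ)
    {j : ℕ} (hjk : j < k) {y : Site d} {κ : Fin d} (hminus : (L : ℤ) • y ∈ Lam L Ω k j)
    (hplus : y + e κ ∈ Lam L Ω k (j + 1)) :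
    AgreeOn ((L : ℤ) • y) ((L : ℤ) • y + blockTop L) (pert (avgIter L U j) (avgIter L U₀ j) * avgIter L U₀ j)
      (pert (V j) (avgIter L U₀ j) * avgIter L U₀ j) := fun x μ hx hxμ => by
  have hb : BondTouches (Lam L Ω k j) x μ :=
    bondTouches_of_block hL hΩ hjk hminus hplus (fun i => (hx i).1) (fun i => (hxμ i).2)
  simp only [Pi.mul_apply, pert, inv_mul_cancel_right]
  exact h3 j hjk.le x μ hb

/-- **The two `B`'s coincide, interior bonds**: for `U ∈ 𝔅_k(𝔅_k, V)`, `(1/i) log Ũ′ʲ_b = (1/i) log(V_b(Ū₀ʲ_b)⁻¹)` at every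
bond `b` touching `Λ_j` — Theorem 2's `B` ((1.37) of [6], `V′ = Ũ′ʲ`) is (20)'s `B` ((1.31) with `V′ = V(Ū₀ʲ)⁻¹`).
[cite: Balaban1985Variational, (20) p.281; Balaban1985RegularSpaces, (1.31) p.82, (1.37) p.82] -/
theorem bint_tilde_eq {L k : ℕ} {Ω : ℕ → Set (Site d)} {V : ℕ → Site d → Fin d → 𝔸ˣ} {U : Site d → Fin d → 𝔸ˣ}
    (h3 : InB L k Ω V U) (U₀ : Site d → Fin d → 𝔸ˣ) {j : ℕ} (hj : j ≤ k) {y : Site d} {κ : Fin d}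
    (hb : BondTouches (Lam L Ω k j) y κ) :
    Bint (pert (avgIter L U j) (avgIter L U₀ j) y κ) = Bint (V j y κ * (avgIter L U₀ j y κ)⁻¹) := by
  rw [pert_avgIter_eq_of_inB h3 U₀ hj hb]

/-- **The two `B`'s coincide, crossing bonds** `b₋ ∈ Λ_j`, `b₊ ∈ Λ_{j+1}` (one level up): for `U ∈ 𝔅_k(𝔅_k, V)` the
second line of (1.31) evaluated at `V′ = Ũ′` equals its value at `V′ = V(Ū₀)⁻¹` (levels `j` inside the exponent,
`j + 1` at `b`). [cite: Balaban1985Variational, (20) p.281; Balaban1985RegularSpaces, (1.31) p.82, (1.37) p.82] -/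
theorem bcross_tilde_eq {L k : ℕ} (hL : 1 ≤ L) {Ω : ℕ → Set (Site d)} (hΩ : DomainSeq L Ω)
    {V : ℕ → Site d → Fin d → 𝔸ˣ} {U : Site d → Fin d → 𝔸ˣ} (h3 : InB L k Ω V U) (U₀ : Site d → Fin d → 𝔸ˣ)
    {j : ℕ} (hjk : j < k) {y : Site d} {κ : Fin d} (hminus : (L : ℤ) • y ∈ Lam L Ω k j)
    (hplus : y + e κ ∈ Lam L Ω k (j + 1)) :
    Bcross L (avgIter L U₀ j) (pert (avgIter L U j) (avgIter L U₀ j)) ((L : ℤ) • y)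
        (pert (avgIter L U (j + 1)) (avgIter L U₀ (j + 1)) y κ)
      = Bcross L (avgIter L U₀ j) (pert (V j) (avgIter L U₀ j)) ((L : ℤ) • y)
        (V (j + 1) y κ * (avgIter L U₀ (j + 1) y κ)⁻¹) := by
  rw [pert_avgIter_eq_of_inB h3 U₀ hjk (Or.inr hplus),
    bcross_congr_of_agreeOn L hL _ _ _ y (agreeOn_block_of_inB hL hΩ h3 U₀ hjk hminus hplus)]

end Dictionary

/-! ## §3 *"hence |B| < 2dLC₁ε₁"* ((20) p. 281) from (14) by (1.37) of [6] -/

section Bound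

variable {𝔸 : Type*} [NormedRing 𝔸] [NormOneClass 𝔸] [NormedAlgebra ℂ 𝔸] [CompleteSpace 𝔸]

/-- **(20), interior bonds**: with (14) `|Ū₀ʲ − V| < C₁ε₁` on `Λ_j` (the form of `B11Eq13Concrete.sat14_L3`), `Ū₀ʲ_b`
unitary (`U1`), `d, L ≥ 1`, `0 < C₁ε₁`, `dLC₁ε₁ ≤ 1/8`: `|B_b| = |(1/i) log(V_b(Ū₀ʲ_b)⁻¹)| < 2dLC₁ε₁` at every level-`j`
bond `b` touching `Λ_j`, `j ≤ k` (print: `b ⊂ Λ_j`) — (1.37) of [6] (`B8Thm2LogB.ineq137_interior`) at `α₁ = C₁ε₁`.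
[cite: Balaban1985Variational, (20) p.281, (14) p.280; Balaban1985RegularSpaces, (1.37) p.82, (1.31) p.82] -/
theorem ineq20_interior (L : ℕ) (hd : 1 ≤ d) (hL : 1 ≤ L) {Ω : ℕ → Set (Site d)} {k : ℕ}
    {V : ℕ → Site d → Fin d → 𝔸ˣ} {U₀ : Site d → Fin d → 𝔸ˣ} {C₁ ε₁ : ℝ} (hCε : 0 < C₁ * ε₁)
    (hsmall : (d : ℝ) * L * (C₁ * ε₁) ≤ 1 / 8)
    (h14 : ∀ j, j ≤ k → ∀ (y : Site d) (κ : Fin d), BondTouches (Lam L Ω k j) y κ →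
      ‖((avgIter L U₀ j y κ : 𝔸ˣ) : 𝔸) - (V j y κ : 𝔸)‖ < C₁ * ε₁)
    {j : ℕ} (hj : j ≤ k) {y : Site d} {κ : Fin d} (hb : BondTouches (Lam L Ω k j) y κ)
    (h₀ : avgIter L U₀ j y κ ∈ U1 𝔸) :
    ‖Bint (V j y κ * (avgIter L U₀ j y κ)⁻¹)‖ < 2 * d * L * C₁ * ε₁ := by
  have hw : ‖((V j y κ * (avgIter L U₀ j y κ)⁻¹ : 𝔸ˣ) : 𝔸) - 1‖ ≤ C₁ * ε₁ := by
    refine (B8Thm2LogB.norm_mul_inv_sub_one_le _ h₀).trans ?_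
    rw [norm_sub_rev]
    exact (h14 j hj y κ hb).le
  exact (B8Thm2LogB.ineq137_interior L hd hL hCε hsmall hw).trans_eq (by ring)

/-- **(20), crossing bonds** `b₋ ∈ Λ_{j−1}`, `b₊ ∈ Λ_j` (stated one level up: `b = ⟨y, y + e_κ⟩` a bond of the
`L^{j+1}η`-lattice with `b₋ ∈ Λ_j`, `b₊ ∈ Λ_{j+1}`, `j + 1 ≤ k`): with the admissibility (1), (14) at the levels `j` and
`j + 1`, unitary (`U1`-valued) data `V_j` and averages `Ū₀ʲ`, `V_b`, `Ū₀^{j+1}_b`, `d, L ≥ 1`, `0 < C₁ε₁`,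
`dLC₁ε₁ ≤ 1/8`: `|B_b| = |(1/i) log(exp[−i Σ_{x∈B(b₋)} L^{−d}(1/i) log(R̄ʲ_{0,b₋}V′)(Γ_{b₋,x})] V′_b)| < 2dLC₁ε₁`,
`V′ = V(Ū₀)⁻¹` — (1.37) of [6] (`B8Thm2LogB.ineq137_of_ineq135`) at `α₁ = C₁ε₁`, (1.35) on `B(b₋)` by (14) + `block_mem_lam`.
[cite: Balaban1985Variational, (20) p.281, (14) p.280, (1) p.277; Balaban1985RegularSpaces, (1.37) p.82, (1.31) p.82, (1.35) p.82] -/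
theorem ineq20_crossing (L : ℕ) (hd : 1 ≤ d) (hL : 1 ≤ L) {Ω : ℕ → Set (Site d)} (hΩ : DomainSeq L Ω) {k : ℕ}
    {V : ℕ → Site d → Fin d → 𝔸ˣ} {U₀ : Site d → Fin d → 𝔸ˣ} {C₁ ε₁ : ℝ} (hCε : 0 < C₁ * ε₁)
    (hsmall : (d : ℝ) * L * (C₁ * ε₁) ≤ 1 / 8)
    (h14 : ∀ j, j ≤ k → ∀ (y : Site d) (κ : Fin d), BondTouches (Lam L Ω k j) y κ →
      ‖((avgIter L U₀ j y κ : 𝔸ˣ) : 𝔸) - (V j y κ : 𝔸)‖ < C₁ * ε₁)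
    {j : ℕ} (hjk : j + 1 ≤ k) {y : Site d} {κ : Fin d} (hminus : (L : ℤ) • y ∈ Lam L Ω k j)
    (hplus : y + e κ ∈ Lam L Ω k (j + 1)) (hV : ∀ x μ, V j x μ ∈ U1 𝔸)
    (hV₀ : ∀ x μ, avgIter L U₀ j x μ ∈ U1 𝔸) (hW : V (j + 1) y κ ∈ U1 𝔸)
    (hW₀ : avgIter L U₀ (j + 1) y κ ∈ U1 𝔸) :
    ‖Bcross L (avgIter L U₀ j) (pert (V j) (avgIter L U₀ j)) ((L : ℤ) • y)
        (V (j + 1) y κ * (avgIter L U₀ (j + 1) y κ)⁻¹)‖ < 2 * d * L * C₁ * ε₁ := by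
  have hjk' : j < k := hjk
  have h135 : ∀ (z : Site d) (μ : Fin d), (L : ℤ) • y ≤ z → z + e μ ≤ (L : ℤ) • y + blockTop L →
      ‖(V j z μ : 𝔸) - (avgIter L U₀ j z μ : 𝔸)‖ ≤ C₁ * ε₁ := fun z μ hz hzμ => by
    rw [norm_sub_rev]
    exact (h14 j hjk'.le z μ (bondTouches_of_block hL hΩ hjk' hminus hplus hz hzμ)).le
  have h135b : ‖(V (j + 1) y κ : 𝔸) - (avgIter L U₀ (j + 1) y κ : 𝔸)‖ ≤ C₁ * ε₁ := by
    rw [norm_sub_rev]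
    exact (h14 (j + 1) hjk y κ (Or.inr hplus)).le
  exact (B8Thm2LogB.ineq137_of_ineq135 L hd hL hCε hsmall (V j) (avgIter L U₀ j) hV hV₀ ((L : ℤ) • y) h135 hW
    hW₀ h135b).2.trans_eq (by ring)

/-- **(20), mirrored crossing bonds** `b₋ ∈ Λ_j`, `b₊ ∈ Λ_{j−1}` (the orientation [6] leaves to the reader, "e.g."
p. 79; one level up: `b₋ = y ∈ Λ_{j+1}`, `b₊ = y + e_κ ∈ Λ_j`), `B_b = (1/i) log(V′_b · R(Ū₀^{j+1}_b) exp[+i Σ_{b₊}])`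
(`B8Thm2LogB.BcrossMirror`): the same bound `|B_b| < 2dLC₁ε₁`, by `B8Thm2LogB.ineq137_crossing_mirrored` with (14)
on the block `B(b₊) ⊂ Λ_j` (`block_mem_lam_mirrored`) and at `b`.
[cite: Balaban1985Variational, (20) p.281, (14) p.280; Balaban1985RegularSpaces, (1.37) p.82, (1.31) p.82, p.79 ("e.g.")] -/
theorem ineq20_crossing_mirrored (L : ℕ) (hd : 1 ≤ d) (hL : 1 ≤ L) {Ω : ℕ → Set (Site d)} (hΩ : DomainSeq L Ω)
    {k : ℕ} {V : ℕ → Site d → Fin d → 𝔸ˣ} {U₀ : Site d → Fin d → 𝔸ˣ} {C₁ ε₁ : ℝ} (hCε : 0 < C₁ * ε₁)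
    (hsmall : (d : ℝ) * L * (C₁ * ε₁) ≤ 1 / 8)
    (h14 : ∀ j, j ≤ k → ∀ (y : Site d) (κ : Fin d), BondTouches (Lam L Ω k j) y κ →
      ‖((avgIter L U₀ j y κ : 𝔸ˣ) : 𝔸) - (V j y κ : 𝔸)‖ < C₁ * ε₁)
    {j : ℕ} (hjk : j + 1 ≤ k) {y : Site d} {κ : Fin d} (hminus : y ∈ Lam L Ω k (j + 1))
    (hplus : (L : ℤ) • (y + e κ) ∈ Lam L Ω k j) (hV : ∀ x μ, V j x μ ∈ U1 𝔸)
    (hV₀ : ∀ x μ, avgIter L U₀ j x μ ∈ U1 𝔸) (hW : V (j + 1) y κ ∈ U1 𝔸)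
    (hW₀ : avgIter L U₀ (j + 1) y κ ∈ U1 𝔸) :
    ‖BcrossMirror L (avgIter L U₀ j) (pert (V j) (avgIter L U₀ j)) ((L : ℤ) • (y + e κ))
        (avgIter L U₀ (j + 1) y κ) (V (j + 1) y κ * (avgIter L U₀ (j + 1) y κ)⁻¹)‖ < 2 * d * L * C₁ * ε₁ := by
  have hjk' : j < k := hjk
  have hs : B8Thm2LogB.BondSmall (pert (V j) (avgIter L U₀ j)) ((L : ℤ) • (y + e κ))
      ((L : ℤ) • (y + e κ) + blockTop L) (C₁ * ε₁) := fun z μ hz hzμ => by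
    refine (B8Thm2LogB.norm_pert_sub_one_le _ _ z μ (hV₀ z μ)).trans ?_
    rw [norm_sub_rev]
    have hb : BondTouches (Lam L Ω k j) z μ := Or.inl (block_mem_lam_mirrored hL hΩ hjk' hminus hplus hz
      ((le_add_of_nonneg_right (e_nonneg μ)).trans hzμ))
    exact (h14 j hjk'.le z μ hb).le
  have hw1 : V (j + 1) y κ * (avgIter L U₀ (j + 1) y κ)⁻¹ ∈ U1 𝔸 := (U1 𝔸).mul_mem hW ((U1 𝔸).inv_mem hW₀)
  have hw : ‖((V (j + 1) y κ * (avgIter L U₀ (j + 1) y κ)⁻¹ : 𝔸ˣ) : 𝔸) - 1‖ ≤ C₁ * ε₁ := by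
    refine (B8Thm2LogB.norm_mul_inv_sub_one_le _ hW₀).trans ?_
    rw [norm_sub_rev]
    exact (h14 (j + 1) hjk y κ (Or.inl hminus)).le
  exact (B8Thm2LogB.ineq137_crossing_mirrored L hd hL hCε hsmall (avgIter L U₀ j) (pert (V j) (avgIter L U₀ j)) hV₀
    (B8Thm2LogB.pert_mem hV hV₀) ((L : ℤ) • (y + e κ)) hs hW₀ hw1 hw).trans_eq (by ring)

/-- **(20) *"where B is given by the formulas (1.31) in [6], hence |B| < 2dLC₁ε₁"*** — the whole clause on the concrete
carriers: for an admissible sequence `{Ω_j}` ((1)), a background `U₀` with (14) `|Ū₀ʲ − V| < C₁ε₁` on `Λ_j`,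
`j = 0, …, k`, unitary data and averages, `d, L ≥ 1`, `0 < C₁ε₁`, `dLC₁ε₁ ≤ 1/8` ([6]'s "α₁ sufficiently small"), the
`B` of (1.31) with `V′ = V(Ū₀ʲ)⁻¹` obeys `|B_b| < 2dLC₁ε₁` on the interior and the crossing bonds (both orientations).
[cite: Balaban1985Variational, (20) p.281, (14) p.280, (1) p.277; Balaban1985RegularSpaces, (1.31) p.82, (1.37) p.82] -/
theorem ineq20 (L : ℕ) (hd : 1 ≤ d) (hL : 1 ≤ L) {Ω : ℕ → Set (Site d)} (hΩ : DomainSeq L Ω) {k : ℕ}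
    {V : ℕ → Site d → Fin d → 𝔸ˣ} {U₀ : Site d → Fin d → 𝔸ˣ} {C₁ ε₁ : ℝ} (hCε : 0 < C₁ * ε₁)
    (hsmall : (d : ℝ) * L * (C₁ * ε₁) ≤ 1 / 8)
    (h14 : ∀ j, j ≤ k → ∀ (y : Site d) (κ : Fin d), BondTouches (Lam L Ω k j) y κ →
      ‖((avgIter L U₀ j y κ : 𝔸ˣ) : 𝔸) - (V j y κ : 𝔸)‖ < C₁ * ε₁)
    (hV : ∀ j x μ, V j x μ ∈ U1 𝔸) (hV₀ : ∀ j x μ, avgIter L U₀ j x μ ∈ U1 𝔸) :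
    (∀ j, j ≤ k → ∀ (y : Site d) (κ : Fin d), BondTouches (Lam L Ω k j) y κ →
        ‖Bint (V j y κ * (avgIter L U₀ j y κ)⁻¹)‖ < 2 * d * L * C₁ * ε₁) ∧
      (∀ j, j + 1 ≤ k → ∀ (y : Site d) (κ : Fin d), (L : ℤ) • y ∈ Lam L Ω k j → y + e κ ∈ Lam L Ω k (j + 1) →
        ‖Bcross L (avgIter L U₀ j) (pert (V j) (avgIter L U₀ j)) ((L : ℤ) • y)
          (V (j + 1) y κ * (avgIter L U₀ (j + 1) y κ)⁻¹)‖ < 2 * d * L * C₁ * ε₁) ∧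
      (∀ j, j + 1 ≤ k → ∀ (y : Site d) (κ : Fin d), y ∈ Lam L Ω k (j + 1) → (L : ℤ) • (y + e κ) ∈ Lam L Ω k j →
        ‖BcrossMirror L (avgIter L U₀ j) (pert (V j) (avgIter L U₀ j)) ((L : ℤ) • (y + e κ))
          (avgIter L U₀ (j + 1) y κ) (V (j + 1) y κ * (avgIter L U₀ (j + 1) y κ)⁻¹)‖ < 2 * d * L * C₁ * ε₁) :=
  ⟨fun _ hj y κ hb => ineq20_interior L hd hL hCε hsmall h14 hj hb (hV₀ _ y κ),
    fun j hjk y κ hm hp => ineq20_crossing L hd hL hΩ hCε hsmall h14 hjk hm hp (hV j) (hV₀ j) (hV _ y κ) (hV₀ _ y κ),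
    fun j hjk y κ hm hp =>
      ineq20_crossing_mirrored L hd hL hΩ hCε hsmall h14 hjk hm hp (hV j) (hV₀ j) (hV _ y κ) (hV₀ _ y κ)⟩

/-- **In the typing of Theorem 2 of [6]** (as the preceding sentence of p. 281 uses it: "U₁ = U′u⁻¹ satisfies the
conditions (1.36)–(1.39) of [6]"): for `U = U′U₀ ∈ 𝔅_k(𝔅_k, V)` ((3)) and `U₀` with (14), the configuration `B` of
(1.37) — (1.31) with `V′ = Ũ′ʲ = tildIter L U₀ U′ j` ((1.20) = (69) of [3]) — satisfies `|B_b| < 2dLC₁ε₁` on interior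
and crossing bonds, being bond by bond the `B` of (20) (`bint_tilde_eq`, `bcross_tilde_eq`).
[cite: Balaban1985Variational, (20) p.281, (3) p.278, (14) p.280; Balaban1985RegularSpaces, (1.37) p.82, (1.20) p.79] -/
theorem ineq20_tilde (L : ℕ) (hd : 1 ≤ d) (hL : 1 ≤ L) {Ω : ℕ → Set (Site d)} (hΩ : DomainSeq L Ω) {k : ℕ}
    {V : ℕ → Site d → Fin d → 𝔸ˣ} {U' U₀ : Site d → Fin d → 𝔸ˣ} (h3 : InB L k Ω V (U' * U₀)) {C₁ ε₁ : ℝ}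
    (hCε : 0 < C₁ * ε₁) (hsmall : (d : ℝ) * L * (C₁ * ε₁) ≤ 1 / 8)
    (h14 : ∀ j, j ≤ k → ∀ (y : Site d) (κ : Fin d), BondTouches (Lam L Ω k j) y κ →
      ‖((avgIter L U₀ j y κ : 𝔸ˣ) : 𝔸) - (V j y κ : 𝔸)‖ < C₁ * ε₁)
    (hV : ∀ j x μ, V j x μ ∈ U1 𝔸) (hV₀ : ∀ j x μ, avgIter L U₀ j x μ ∈ U1 𝔸) :
    (∀ j, j ≤ k → ∀ (y : Site d) (κ : Fin d), BondTouches (Lam L Ω k j) y κ →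
        ‖Bint (tildIter L U₀ U' j y κ)‖ < 2 * d * L * C₁ * ε₁) ∧
      (∀ j, j + 1 ≤ k → ∀ (y : Site d) (κ : Fin d), (L : ℤ) • y ∈ Lam L Ω k j → y + e κ ∈ Lam L Ω k (j + 1) →
        ‖Bcross L (avgIter L U₀ j) (tildIter L U₀ U' j) ((L : ℤ) • y) (tildIter L U₀ U' (j + 1) y κ)‖
          < 2 * d * L * C₁ * ε₁) := by
  refine ⟨fun j hj y κ hb => ?_, fun j hjk y κ hm hp => ?_⟩
  · rw [← pert_avgIter_eq_tildIter, bint_tilde_eq h3 U₀ hj hb]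
    exact ineq20_interior L hd hL hCε hsmall h14 hj hb (hV₀ _ y κ)
  · rw [← pert_avgIter_eq_tildIter, ← pert_avgIter_eq_tildIter, bcross_tilde_eq hL hΩ h3 U₀ hjk hm hp]
    exact ineq20_crossing L hd hL hΩ hCε hsmall h14 hjk hm hp (hV j) (hV₀ j) (hV _ y κ) (hV₀ _ y κ)

end Bound

end Literature.MathematicalPhysics.QuantumFieldTheory.Balaban1983to89.B11Eq20BoundB

end
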